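import Mathlib
import Summits.ResolutionOfSingularities.ResolutionOfSingularities.Theorems.HomologicalConductorPersistenceCyclicTransferStable
import HarnessLib

/-!
# Crux `Persistence` (stmt-16484) / rung S-2 `PersistenceSurface` (stmt-19970) — cyclic transfer, part 4:
# COINDUCTION — every `U`-module is the module of invariants of its coextension `Hom_U(V, N)`
# (chain W4.4b, seat res-L1-w44b-stub-4 gen 4; planner's VERONESE LEMMA T-V, S2-BRIEF v1.2, step (T-V-a))

[OURS · L1 w44b] Nothing here is a statement of the manuscript under review (Hironaka 2017); AI-written, weaker
than expert review.

SETTING. `U → V` commutative, `σ : V →ₐ[U] V` with `σ ^ d = 1` whose fixed ring is the injective image of `U`,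
`d ∈ Uˣ`.  For ANY `U`-module `N` let `M := Hom_U(V, N)` be the COEXTENDED module — in Mathlib's spelling the
`V`-module `((ModuleCat.restrictScalars (algebraMap U V)).obj (ModuleCat.of V V)) →ₗ[U] N` with
`(w • φ) v = φ (v w)` (`ModuleCat.CoextendScalars`).  Then:
* `exists_reynolds` — the REYNOLDS OPERATOR `ρ : V →ₗ[U] U`, `ρ ∘ algebraMap = id`, `ρ ∘ σ = ρ`,
  `d · algebraMap (ρ v) = ∑_{i<d} σⁱ v`;
* `isScalarTower_coinduced` — `U → V → Hom_U(V, N)` is a scalar tower;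
* `exists_coinduced_data` — the `σ`-semilinear automorphism `τ φ = φ ∘ σ^{d-1}` of `M` (`τ^[d] = id`) and the
  `U`-linear injection `j : N ↪ M`, `j n = (v ↦ ρ(v) n)`, whose range is EXACTLY the `τ`-invariants
  (`φ ∘ σ = φ ⟹ φ(v) = ρ(v) φ(1)` by averaging over the group and dividing by `d`);
* **`StablyAnnihilates.of_coinduced_isotypic`** — T-V-a: if `c` (character `ω^γ`) stably annihilates
  `Hom_U(V, N)` over `V` and `a ∈ 𝔞_γ` (isotypic product ideal, given by decompositions), then `a c` stably
  annihilates `N` over `U` (part 3 `StablyAnnihilates.fixed_of_isotypic` applied to the coinduced data);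
  `StablyAnnihilates.of_coinduced_pow` — the pure-power form `w ↦ w^d`.

What remains for the planner's T-V «`ca(R^G) ⊇ 𝔞·(ca(R) ∩ R^G)`» is the MCM input (T-V-b): for `N` a second
syzygy over `U`, `Hom_U(V, N)` is a second syzygy over `V` (normal domains; height-one criterion) — not in this file.

References: Iyengar–Takahashi, IMRN 2016, arXiv:1404.1476, Remark 2.13 [`IyengarTakahashi2014`]; Reynolds operator
and coinduction are folklore.
-/

-- single-problem summit: the doubled namespace component `ResolutionOfSingularities` is forced
set_option linter.dupNamespace false

noncomputable section

open CategoryTheory Literature.RingTheory.CohomologyAnnihilator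
open Summit.ResolutionOfSingularities.ResolutionOfSingularities.Theorems.NoZeno.SandwichCluster
open Summit.ResolutionOfSingularities.ResolutionOfSingularities.Theorems.HomologicalConductor.PersistenceSurfaceHullCover
open Summit.ResolutionOfSingularities.ResolutionOfSingularities.Theorems.HomologicalConductor.PersistenceCyclicTransferFamily
open Summit.ResolutionOfSingularities.ResolutionOfSingularities.Theorems.HomologicalConductor.PersistenceCyclicTransferGeneral
open Summit.ResolutionOfSingularities.ResolutionOfSingularities.Theorems.HomologicalConductor.PersistenceCyclicTransferStable

universe u

namespace Summit.ResolutionOfSingularities.ResolutionOfSingularities.Theorems.HomologicalConductor.PersistenceCyclicTransferCoinduced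

variable {U V : Type u} [CommRing U] [CommRing V] [Algebra U V]

/-! ## The Reynolds operator -/

/-- Sums over the cyclic group are `σ`-stable: `∑_{i<d} σ^{i+1} v = ∑_{i<d} σⁱ v` when `σ ^ d = 1`. [folklore] -/
theorem sum_pow_succ_apply_eq (σ : V →ₐ[U] V) {d : ℕ} (hσd : σ ^ d = 1) (v : V) :
    ∑ i ∈ Finset.range d, (σ ^ (i + 1)) v = ∑ i ∈ Finset.range d, (σ ^ i) v :=
  sum_range_succ_shift d (fun i => (σ ^ i) v) (by rw [hσd, pow_zero])

/-- The Reynolds operator is invariant under every power of `σ`. [folklore] -/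
theorem apply_pow_eq_of_apply_eq (σ : V →ₐ[U] V) {X : Type*} (ρ : V → X) (hρ : ∀ v, ρ (σ v) = ρ v)
    (k : ℕ) (v : V) : ρ ((σ ^ k) v) = ρ v := by
  induction k generalizing v with
  | zero => simp
  | succ k ih => rw [pow_succ', AlgHom.mul_apply, hρ, ih]

/-- **The Reynolds operator.**  With `σ ^ d = 1`, fixed ring `= algebraMap U` (injective) and `d ∈ Uˣ` there is
a `U`-linear `ρ : V → U` with `ρ (algebraMap u) = u`, `ρ (σ v) = ρ v` and `d · algebraMap (ρ v) = ∑_{i<d} σⁱ v`.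
[folklore] -/
theorem exists_reynolds (σ : V →ₐ[U] V) {d : ℕ} (hσd : σ ^ d = 1)
    (hfix : ∀ v : V, σ v = v → ∃ u : U, algebraMap U V u = v) (hinj : Function.Injective (algebraMap U V))
    (hdU : IsUnit ((d : ℕ) : U)) :
    ∃ ρ : V →ₗ[U] U, (∀ u, ρ (algebraMap U V u) = u) ∧ (∀ v, ρ (σ v) = ρ v) ∧
      ∀ v, (d : V) * algebraMap U V (ρ v) = ∑ i ∈ Finset.range d, (σ ^ i) v := by
  classical
  choose φ hφ using hfix
  obtain ⟨du, hdu⟩ := hdU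
  have hPfix : ∀ v, σ (∑ i ∈ Finset.range d, (σ ^ i) v) = ∑ i ∈ Finset.range d, (σ ^ i) v := by
    intro v
    rw [map_sum]
    have : ∀ i, σ ((σ ^ i) v) = (σ ^ (i + 1)) v := fun i => by rw [pow_succ', AlgHom.mul_apply]
    simp_rw [this]
    exact sum_pow_succ_apply_eq σ hσd v
  have hdd : algebraMap U V ↑du⁻¹ * (d : V) = 1 := by
    rw [← map_natCast (algebraMap U V) d, ← hdu, ← map_mul, Units.inv_mul, map_one]
  let ρ₀ : V → U := fun v => ↑du⁻¹ * φ _ (hPfix v)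
  have hρ₀ : ∀ v, algebraMap U V (ρ₀ v) = algebraMap U V ↑du⁻¹ * ∑ i ∈ Finset.range d, (σ ^ i) v :=
    fun v => by simp only [ρ₀, map_mul, hφ]
  refine ⟨{ toFun := ρ₀, map_add' := ?_, map_smul' := ?_ }, ?_, ?_, ?_⟩
  · intro v w
    apply hinj
    rw [map_add, hρ₀, hρ₀, hρ₀]
    simp only [map_add, Finset.sum_add_distrib, mul_add]
  · intro u v
    apply hinj
    rw [hρ₀, RingHom.id_apply, smul_eq_mul, map_mul, hρ₀]
    simp only [Algebra.smul_def, map_mul, AlgHom.commutes, ← Finset.mul_sum]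
    ring
  · intro u
    apply hinj
    change algebraMap U V (ρ₀ _) = _
    rw [hρ₀]
    simp only [AlgHom.commutes, Finset.sum_const, Finset.card_range, nsmul_eq_mul]
    rw [← mul_assoc, hdd, one_mul]
  · intro v
    apply hinj
    change algebraMap U V (ρ₀ _) = algebraMap U V (ρ₀ _)
    rw [hρ₀, hρ₀]
    congr 1
    have : ∀ i, (σ ^ i) (σ v) = (σ ^ (i + 1)) v := fun i => by rw [pow_succ, AlgHom.mul_apply]
    simp_rw [this]
    exact sum_pow_succ_apply_eq σ hσd v
  · intro v
    change (d : V) * algebraMap U V (ρ₀ v) = _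
    rw [hρ₀, ← mul_assoc, mul_comm (d : V), hdd, one_mul]

/-! ## The coextended module `Hom_U(V, N)` and its `σ`-semilinear automorphism -/

/-- `U → V → Hom_U(V, N)` is a scalar tower for the coextended `V`-structure `(w • φ) v = φ (v w)` and the
pointwise `U`-structure. [folklore] -/
theorem isScalarTower_coinduced (N : Type u) [AddCommGroup N] [Module U N] :
    IsScalarTower U V (((ModuleCat.restrictScalars (algebraMap U V)).obj (ModuleCat.of V V)) →ₗ[U] N) := by
  let toW : V → ((ModuleCat.restrictScalars (algebraMap U V)).obj (ModuleCat.of V V)) := fun v => v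
  let ofW : ((ModuleCat.restrictScalars (algebraMap U V)).obj (ModuleCat.of V V)) → V := fun w => w
  constructor
  intro u w φ
  apply LinearMap.ext
  intro v
  rw [LinearMap.smul_apply, ModuleCat.CoextendScalars.smul_apply', ModuleCat.CoextendScalars.smul_apply',
    ← map_smul]
  congr 1
  change toW (ofW v * (u • w)) = toW (algebraMap U V u * (ofW v * w))
  rw [Algebra.smul_def]
  congr 1
  ring

/-- **The coinduced data.**  For every `U`-module `N`: a `σ`-semilinear additive automorphism `τ` of
`M = Hom_U(V, N)` with `τ^[d] = id` (`τ φ = φ ∘ σ^{d-1}`) and a `U`-linear injection `j : N ↪ M`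
(`j n = (v ↦ ρ(v) n)`) whose range is exactly the `τ`-fixed vectors. [folklore] -/
theorem exists_coinduced_data (σ : V →ₐ[U] V) {d : ℕ} (hd : 0 < d) (hσd : σ ^ d = 1)
    (hfix : ∀ v : V, σ v = v → ∃ u : U, algebraMap U V u = v) (hinj : Function.Injective (algebraMap U V))
    (hdU : IsUnit ((d : ℕ) : U)) (N : Type u) [AddCommGroup N] [Module U N] :
    ∃ (τ : (((ModuleCat.restrictScalars (algebraMap U V)).obj (ModuleCat.of V V)) →ₗ[U] N) →+
        (((ModuleCat.restrictScalars (algebraMap U V)).obj (ModuleCat.of V V)) →ₗ[U] N))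
      (j : N →ₗ[U] (((ModuleCat.restrictScalars (algebraMap U V)).obj (ModuleCat.of V V)) →ₗ[U] N)),
      (∀ (w : V) φ, τ (w • φ) = σ w • τ φ) ∧ (∀ φ, (⇑τ)^[d] φ = φ) ∧ Function.Injective j ∧
        (∀ n, τ (j n) = j n) ∧ ∀ φ, τ φ = φ → ∃ n, j n = φ := by
  obtain ⟨e, rfl⟩ : ∃ e, d = e + 1 := ⟨d - 1, by omega⟩
  obtain ⟨ρ, hρalg, hρσ, hρsum⟩ := exists_reynolds σ hσd hfix hinj hdU
  obtain ⟨du, hdu⟩ := hdU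
  have hρpow : ∀ k v, ρ ((σ ^ k) v) = ρ v := apply_pow_eq_of_apply_eq σ ρ hρσ
  -- the two identifications of the carrier of the source `V|_U` with `V`
  let toW : V → ((ModuleCat.restrictScalars (algebraMap U V)).obj (ModuleCat.of V V)) := fun v => v
  let ofW : ((ModuleCat.restrictScalars (algebraMap U V)).obj (ModuleCat.of V V)) → V := fun w => w
  have smul_apply'' : ∀ (w : V) (φ : ((ModuleCat.restrictScalars (algebraMap U V)).obj (ModuleCat.of V V))
      →ₗ[U] N) v, (w • φ) v = φ (toW (ofW v * w)) := fun _ _ _ => rfl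
  -- powers of `σ^e` exhaust the group: `(σ^e)^(e+1-i) = σ^i`
  have hσpow : ∀ i, i ≤ e → (σ ^ e) ^ (e + 1 - i) = σ ^ i := by
    intro i hi
    obtain ⟨r, rfl⟩ := Nat.exists_eq_add_of_le hi
    rw [← pow_mul, show i + r + 1 - i = r + 1 by omega,
      show (i + r) * (r + 1) = i + (i + r + 1) * r by ring, pow_add, pow_mul, hσd, one_pow, mul_one]
  -- `σ^e` on the source, as a `U`-linear map
  let s : ((ModuleCat.restrictScalars (algebraMap U V)).obj (ModuleCat.of V V)) →ₗ[U]
      ((ModuleCat.restrictScalars (algebraMap U V)).obj (ModuleCat.of V V)) :=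
    { toFun := fun w => toW ((σ ^ e) (ofW w))
      map_add' := fun w w' => by
        change toW ((σ ^ e) (ofW w + ofW w')) = toW ((σ ^ e) (ofW w) + (σ ^ e) (ofW w'))
        rw [map_add]
      map_smul' := fun u w => by
        change toW ((σ ^ e) (algebraMap U V u * ofW w)) = toW (algebraMap U V u * (σ ^ e) (ofW w))
        rw [map_mul, AlgHom.commutes] }
  have s_apply : ∀ w, s w = toW ((σ ^ e) (ofW w)) := fun _ => rfl
  -- the semilinear automorphism `τ φ = φ ∘ σ^e`
  let τ : (((ModuleCat.restrictScalars (algebraMap U V)).obj (ModuleCat.of V V)) →ₗ[U] N) →+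
      (((ModuleCat.restrictScalars (algebraMap U V)).obj (ModuleCat.of V V)) →ₗ[U] N) :=
    { toFun := fun φ => φ ∘ₗ s
      map_zero' := LinearMap.zero_comp s
      map_add' := fun φ ψ => LinearMap.add_comp s ψ φ }
  have τ_apply : ∀ φ v, τ φ v = φ (s v) := fun _ _ => rfl
  have τ_iter : ∀ n φ (v : V), ((⇑τ)^[n] φ) (toW v) = φ (toW (((σ ^ e) ^ n) v)) := by
    intro n
    induction n with
    | zero => intro φ v; rw [Function.iterate_zero_apply, pow_zero, AlgHom.one_apply]
    | succ n ih =>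
      intro φ v
      rw [Function.iterate_succ_apply, ih, τ_apply, s_apply, pow_succ', AlgHom.mul_apply]
  -- the injection `j n = (v ↦ ρ(v) n)`
  let j : N →ₗ[U] (((ModuleCat.restrictScalars (algebraMap U V)).obj (ModuleCat.of V V)) →ₗ[U] N) :=
    { toFun := fun n =>
        { toFun := fun v => ρ (ofW v) • n
          map_add' := fun v w => by
            change ρ (ofW v + ofW w) • n = _
            rw [map_add, add_smul]
          map_smul' := fun u v => by
            change ρ (algebraMap U V u * ofW v) • n = u • ρ (ofW v) • n
            rw [← Algebra.smul_def, map_smul, smul_eq_mul, mul_smul] }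
      map_add' := fun n n' => by
        apply LinearMap.ext
        intro v
        simp only [smul_add, LinearMap.coe_mk, AddHom.coe_mk, LinearMap.add_apply]
      map_smul' := fun u n => by
        apply LinearMap.ext
        intro v
        simp only [LinearMap.coe_mk, AddHom.coe_mk, LinearMap.smul_apply, RingHom.id_apply, smul_comm (ρ _) u n] }
  have j_apply : ∀ n v, j n v = ρ (ofW v) • n := fun _ _ => rfl
  refine ⟨τ, j, ?_, ?_, ?_, ?_, ?_⟩
  · -- semilinearity
    intro w φ
    apply LinearMap.ext
    intro v
    rw [τ_apply, smul_apply'', smul_apply'', τ_apply, s_apply, s_apply]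
    congr 1
    change toW ((σ ^ e) (ofW v) * w) = toW ((σ ^ e) (ofW v * σ w))
    rw [map_mul, ← AlgHom.mul_apply, ← pow_succ, hσd, AlgHom.one_apply]
  · -- period `e + 1`
    intro φ
    apply LinearMap.ext
    intro v
    change ((⇑τ)^[e + 1] φ) (toW (ofW v)) = φ (toW (ofW v))
    rw [τ_iter, ← pow_mul, mul_comm, pow_mul, hσd, one_pow, AlgHom.one_apply]
  · -- injectivity: evaluate at `1`
    intro n n' h
    have h1 := congrArg (fun φ => φ (toW 1)) h
    simp only [j_apply] at h1
    change ρ 1 • n = ρ 1 • n' at h1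
    rwa [← (algebraMap U V).map_one, hρalg, one_smul, one_smul] at h1
  · -- `j n` is `τ`-invariant
    intro n
    apply LinearMap.ext
    intro v
    rw [τ_apply, j_apply, j_apply, s_apply]
    exact congrArg (· • n) (hρpow e (ofW v))
  · -- every invariant is in the range: `φ = j (φ 1)`
    intro φ hφ
    refine ⟨φ (toW 1), ?_⟩
    apply LinearMap.ext
    intro v
    rw [j_apply]
    -- `φ (σ^i v) = φ v` for all `i ≤ e`
    have hk : ∀ k, φ (toW (((σ ^ e) ^ k) (ofW v))) = φ v := fun k => by
      rw [← τ_iter, Function.iterate_fixed hφ k]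
    have hi : ∀ i ∈ Finset.range (e + 1), φ (toW ((σ ^ i) (ofW v))) = φ v := fun i hi => by
      rw [← hσpow i (by simpa [Finset.mem_range, Nat.lt_succ_iff] using hi), hk]
    -- average
    have hsum : ∑ i ∈ Finset.range (e + 1), φ (toW ((σ ^ i) (ofW v))) = ((e + 1 : ℕ) : U) • φ v := by
      rw [Finset.sum_congr rfl hi, Finset.sum_const, Finset.card_range, Nat.cast_smul_eq_nsmul]
    have hsum' : ∑ i ∈ Finset.range (e + 1), φ (toW ((σ ^ i) (ofW v))) =
        (((e + 1 : ℕ) : U) * ρ (ofW v)) • φ (toW 1) := by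
      rw [← map_sum, ← map_smul]
      congr 1
      change toW (∑ i ∈ Finset.range (e + 1), (σ ^ i) (ofW v)) = toW (algebraMap U V (↑(e + 1) * ρ (ofW v)) * 1)
      rw [← hρsum, map_mul, map_natCast, mul_one]
    have key : ((e + 1 : ℕ) : U) • φ v = ((e + 1 : ℕ) : U) • (ρ (ofW v) • φ (toW 1)) := by
      rw [← hsum, hsum', mul_smul]
    have := congrArg (fun x => (↑du⁻¹ : U) • x) key
    simp only [smul_smul, ← hdu, Units.inv_mul, one_smul, Units.inv_mul_cancel_left] at this
    exact this.symm

/-! ## T-V-a: stable annihilation descends along the coinduction -/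

/-- **T-V-a (isotypic form).**  If `c` (character `ω^γ`) stably annihilates the coextended module `Hom_U(V, N)`
over `V`, and `a ∈ 𝔞_γ` (for each `j < d`: `a = ∑_k b_k b'_k`, `σ b_k = ω^j b_k`, `σ b'_k = ω^l b'_k`,
`d ∣ j + l + γ`), then `a c` stably annihilates `N` over `U`. [folklore] -/
theorem StablyAnnihilates.of_coinduced_isotypic (σ : V →ₐ[U] V) {d : ℕ} (hd : 0 < d) (hσd : σ ^ d = 1)
    (hfix : ∀ v : V, σ v = v → ∃ u : U, algebraMap U V u = v) (hinj : Function.Injective (algebraMap U V))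
    (ω : U) (hωd : ω ^ d = 1) (horth : ∀ m : ℕ, ¬ d ∣ m → ∑ i ∈ Finset.range d, ω ^ (m * i) = 0)
    (hdU : IsUnit ((d : ℕ) : U)) {c : V} (gc : ℕ) (hc : σ c = algebraMap U V ω ^ gc * c) {a : V}
    (ha : ∀ j' : Fin d, ∃ (n : ℕ) (b b' : Fin n → V) (l : ℕ), (∀ k, σ (b k) = algebraMap U V ω ^ (j' : ℕ) * b k) ∧
      (∀ k, σ (b' k) = algebraMap U V ω ^ l * b' k) ∧ d ∣ (j' : ℕ) + l + gc ∧ ∑ k, b k * b' k = a)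
    (N : Type u) [AddCommGroup N] [Module U N]
    (h : StablyAnnihilates V c
      (ModuleCat.of V (((ModuleCat.restrictScalars (algebraMap U V)).obj (ModuleCat.of V V)) →ₗ[U] N)))
    (u : U) (hu : algebraMap U V u = a * c) : StablyAnnihilates U u (ModuleCat.of U N) := by
  haveI := isScalarTower_coinduced (U := U) (V := V) N
  obtain ⟨τ, j, hτ, hτd, hjinj, hjτ, hjsurj⟩ := exists_coinduced_data σ hd hσd hfix hinj hdU N
  exact StablyAnnihilates.fixed_of_isotypic σ hd hσd hfix hinj ω hωd horth hdU τ hτ hτd j hjinj hjτ hjsurj gc hc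
    ha h u hu

/-- **T-V-a (pure-power form).**  If `w` with `σ w = ω w` stably annihilates `Hom_U(V, N)` over `V`, then `w ^ d`
(as `u ∈ U`) stably annihilates `N` over `U`. [folklore] -/
theorem StablyAnnihilates.of_coinduced_pow (σ : V →ₐ[U] V) {d : ℕ} (hd : 0 < d) (hσd : σ ^ d = 1)
    (hfix : ∀ v : V, σ v = v → ∃ u : U, algebraMap U V u = v) (hinj : Function.Injective (algebraMap U V))
    (ω : U) (hωd : ω ^ d = 1) (horth : ∀ m : ℕ, ¬ d ∣ m → ∑ i ∈ Finset.range d, ω ^ (m * i) = 0)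
    (hdU : IsUnit ((d : ℕ) : U)) {w : V} (hw : σ w = algebraMap U V ω * w)
    (N : Type u) [AddCommGroup N] [Module U N]
    (h : StablyAnnihilates V w
      (ModuleCat.of V (((ModuleCat.restrictScalars (algebraMap U V)).obj (ModuleCat.of V V)) →ₗ[U] N)))
    (u : U) (hu : algebraMap U V u = w ^ d) : StablyAnnihilates U u (ModuleCat.of U N) := by
  haveI := isScalarTower_coinduced (U := U) (V := V) N
  obtain ⟨τ, j, hτ, hτd, hjinj, hjτ, hjsurj⟩ := exists_coinduced_data σ hd hσd hfix hinj hdU N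
  exact StablyAnnihilates.fixed_pow_of_cyclic σ hd hσd hfix hinj ω hωd horth hdU τ hτ hτd j hjinj hjτ hjsurj hw
    h u hu

/-! ## T-V modulo the syzygy input (T-V-b): the COHOMOLOGY-ANNIHILATOR form -/

/-- **Veronese lemma T-V at level `n+1`, modulo the syzygy input.**  `U`, `V` noetherian.  Suppose (T-V-b) that
the coextension `Hom_U(V, K)` of every `n`-th syzygy `K` of a finitely generated `U`-module is an `n`-th syzygy of
some finitely generated `V`-module.  Then for `c ∈ caⁿ⁺¹(V)` of character `ω^γ` and `a ∈ 𝔞_γ` (isotypic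
decompositions), `a c ∈ caⁿ⁺¹(U)`: CA1 over `V` makes `c` stably annihilate `Hom_U(V, K)`, T-V-a descends it to
`K`, CA1 over `U` concludes.  (T-V-b holds e.g. when the Reynolds pairing `V ≅ Hom_U(V, U)` is perfect — part 5.)
[folklore] -/
theorem mul_mem_cohomologyAnnihilatorOfDegree_of_coinduced_syzygy [IsNoetherianRing U] [IsNoetherianRing V]
    (σ : V →ₐ[U] V) {d : ℕ} (hd : 0 < d) (hσd : σ ^ d = 1)
    (hfix : ∀ v : V, σ v = v → ∃ u : U, algebraMap U V u = v) (hinj : Function.Injective (algebraMap U V))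
    (ω : U) (hωd : ω ^ d = 1) (horth : ∀ m : ℕ, ¬ d ∣ m → ∑ i ∈ Finset.range d, ω ^ (m * i) = 0)
    (hdU : IsUnit ((d : ℕ) : U)) (n : ℕ)
    (hcoind : ∀ (X K : ModuleCat.{u} U), Module.Finite U X → IsSyzygy n X K →
      ∃ X' : ModuleCat.{u} V, Module.Finite V X' ∧ IsSyzygy n X'
        (ModuleCat.of V (((ModuleCat.restrictScalars (algebraMap U V)).obj (ModuleCat.of V V)) →ₗ[U] K)))
    {c : V} (hcn : c ∈ cohomologyAnnihilatorOfDegree V (n + 1)) (gc : ℕ)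
    (hc : σ c = algebraMap U V ω ^ gc * c) {a : V}
    (ha : ∀ j' : Fin d, ∃ (m : ℕ) (b b' : Fin m → V) (l : ℕ), (∀ k, σ (b k) = algebraMap U V ω ^ (j' : ℕ) * b k) ∧
      (∀ k, σ (b' k) = algebraMap U V ω ^ l * b' k) ∧ d ∣ (j' : ℕ) + l + gc ∧ ∑ k, b k * b' k = a)
    (u : U) (hu : algebraMap U V u = a * c) : u ∈ cohomologyAnnihilatorOfDegree U (n + 1) := by
  refine (mem_cohomologyAnnihilatorOfDegree_succ_iff_forall_isSyzygy u).mpr fun X K hX hK => ?_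
  obtain ⟨X', hX', hK'⟩ := hcoind X K hX hK
  have hcK := (mem_cohomologyAnnihilatorOfDegree_succ_iff_forall_isSyzygy c).mp hcn X' _ hX' hK'
  exact StablyAnnihilates.of_coinduced_isotypic σ hd hσd hfix hinj ω hωd horth hdU gc hc ha K hcK u hu

end Summit.ResolutionOfSingularities.ResolutionOfSingularities.Theorems.HomologicalConductor.PersistenceCyclicTransferCoinduced

end
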